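import Mathlib
import HarnessLib
import Literature.Probability.Percolation.QuadCrossingSquareModel
import Literature.Barriers.CriticalPhenomena.EmbeddingModulusUniquenessProofs
import Literature.Probability.RandomPlanarGeometry.ConformalRectangleProofs
import Literature.Probability.RandomPlanarGeometry.ChordalCurveFamily
import Literature.Probability.RandomPlanarGeometry.DiamondShearChart

/-!
# Crux `SegmentOpen` (stmt-CriticalPhenomena-5471), line `Sketch` — stub `stub_capacity_invariant`

Conformal invariance of the set of Dirichlet energies of admissible test functions of a conformal
rectangle (Ahlfors, *Conformal Invariants*, Ch. 4: the Dirichlet integral is a conformal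
invariant). Given a conformal equivalence `ψ : R₁.carrier → R₂.carrier` whose boundary values
carry `R₁.arc 0` into `R₂.arc 0` and `R₁.arc 2` into `R₂.arc 2`, every admissible `U` on `R₂`
pulls back to the admissible `U ∘ ψ` on `R₁` with the same energy: pointwise
`‖d(U ∘ ψ) z‖ = ‖ψ' z‖ · ‖dU (ψ z)‖`, and the real Jacobian of `ψ` is `‖ψ' z‖ ²`
(change of variables `MeasureTheory.integral_image_eq_integral_abs_det_fderiv_smul`). The same
argument for `ψ.symm` gives the reverse inclusion.
-/

noncomputable section

namespace Summit.CriticalPhenomena.CardyFormulaZ2.Theorems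

open Literature.Probability Literature.Barriers.CriticalPhenomena
open Literature.Probability.RandomPlanarGeometry (ConformalRectangle ConformalEquiv MarkedDomain)
open Filter Set Topology MeasureTheory
open UpperHalfPlane (upperHalfPlaneSet)

/-- Operator norm of a real-linear functional precomposed with complex multiplication by `c`:
`‖ℓ ∘ (c • 1)‖ = ‖c‖ * ‖ℓ‖` (multiplication by `c / ‖c‖` is an isometry of `ℂ`). -/
private theorem norm_comp_smul_one (ℓ : ℂ →L[ℝ] ℝ) (c : ℂ) :
    ‖ℓ.comp (c • (1 : ℂ →L[ℝ] ℂ))‖ = ‖c‖ * ‖ℓ‖ := by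
  apply le_antisymm
  · refine ContinuousLinearMap.opNorm_le_bound _ (by positivity) fun x => ?_
    calc ‖ℓ.comp (c • (1 : ℂ →L[ℝ] ℂ)) x‖ = ‖ℓ (c * x)‖ := by simp
      _ ≤ ‖ℓ‖ * ‖c * x‖ := ℓ.le_opNorm _
      _ = ‖c‖ * ‖ℓ‖ * ‖x‖ := by rw [norm_mul]; ring
  · rcases eq_or_ne c 0 with rfl | hc
    · simp
    · have hc' : 0 < ‖c‖ := norm_pos_iff.2 hc
      rw [← le_div_iff₀' hc']
      refine ContinuousLinearMap.opNorm_le_bound _ (by positivity) fun x => ?_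
      have hx : ℓ x = ℓ.comp (c • (1 : ℂ →L[ℝ] ℂ)) (c⁻¹ * x) := by
        simp [← mul_assoc, mul_inv_cancel₀ hc]
      rw [hx]
      calc ‖ℓ.comp (c • (1 : ℂ →L[ℝ] ℂ)) (c⁻¹ * x)‖
          ≤ ‖ℓ.comp (c • (1 : ℂ →L[ℝ] ℂ))‖ * ‖c⁻¹ * x‖ := ContinuousLinearMap.le_opNorm _ _
        _ = ‖ℓ.comp (c • (1 : ℂ →L[ℝ] ℂ))‖ / ‖c‖ * ‖x‖ := by
          rw [norm_mul, norm_inv]; ring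

/-- The real Jacobian determinant of complex multiplication by `c` is `‖c‖ ^ 2`. -/
private theorem det_smul_one (c : ℂ) : (c • (1 : ℂ →L[ℝ] ℂ)).det = ‖c‖ ^ 2 := by
  have h : ((c • (1 : ℂ →L[ℝ] ℂ) : ℂ →L[ℝ] ℂ) : ℂ →ₗ[ℝ] ℂ) = Algebra.lmul ℝ ℂ c := by
    ext w
    simp
  rw [ContinuousLinearMap.det, h]
  change LinearMap.det (Algebra.lmul ℝ ℂ c) = _
  rw [← Algebra.norm_apply, Algebra.norm_complex_apply, Complex.normSq_eq_norm_sq]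

/-- Transport of a locally constant boundary condition along boundary values: if `ψ` maps `S₁`
into `S₂`, tends within `S₁` at every point of `A₁` to a point of `A₂`, and `U = a` on `O ∩ S₂` for
an open `O ⊇ A₂`, then `U ∘ ψ = a` on `O' ∩ S₁` for an open `O' ⊇ A₁`. -/
private theorem boundaryCondition_comp {S₁ S₂ A₁ A₂ : Set ℂ} (ψ : ℂ → ℂ) (hmaps : MapsTo ψ S₁ S₂)
    (hbv : ∀ z ∈ A₁, ∃ p ∈ A₂, Tendsto ψ (𝓝[S₁] z) (𝓝 p)) {U : ℂ → ℝ} {a : ℝ}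
    (hU : ∃ O : Set ℂ, IsOpen O ∧ A₂ ⊆ O ∧ ∀ z ∈ O ∩ S₂, U z = a) :
    ∃ O : Set ℂ, IsOpen O ∧ A₁ ⊆ O ∧ ∀ z ∈ O ∩ S₁, U (ψ z) = a := by
  obtain ⟨O, hO, hAO, hUO⟩ := hU
  have key : ∀ z ∈ A₁, ∃ W : Set ℂ, IsOpen W ∧ z ∈ W ∧ ∀ w ∈ W ∩ S₁, ψ w ∈ O := by
    intro z hz
    obtain ⟨p, hp, hT⟩ := hbv z hz
    have hmem : ψ ⁻¹' O ∈ 𝓝[S₁] z := hT (hO.mem_nhds (hAO hp))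
    obtain ⟨W, hW, hzW, hWsub⟩ := mem_nhdsWithin.1 hmem
    exact ⟨W, hW, hzW, fun w hw => hWsub hw⟩
  choose! W hWo hzW hWψ using key
  refine ⟨⋃ z ∈ A₁, W z, isOpen_biUnion fun z hz => hWo z hz,
    fun z hz => mem_biUnion hz (hzW z hz), ?_⟩
  rintro w ⟨hw, hwS⟩
  obtain ⟨z, hz, hwz⟩ := mem_iUnion₂.1 hw
  exact hUO _ ⟨hWψ z hz w ⟨hwz, hwS⟩, hmaps hwS⟩

/-- Chain rule for `U ∘ ψ` with `ψ` a conformal equivalence between open sets and `U` of class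
`C¹` on the target: the real derivative is `dU (ψ z) ∘ (ψ' z • 1)`. -/
private theorem hasFDerivAt_comp_conformal {S₁ S₂ : Set ℂ} (ψ : ConformalEquiv S₁ S₂)
    (hS₁ : IsOpen S₁) (hS₂ : IsOpen S₂) {U : ℂ → ℝ} (hU : ContDiffOn ℝ 1 U S₂) {z : ℂ}
    (hz : z ∈ S₁) :
    HasFDerivAt (fun w => U (ψ w))
      ((fderiv ℝ U (ψ z)).comp (deriv ψ z • (1 : ℂ →L[ℝ] ℂ))) z := by
  have hψ : HasFDerivAt ψ (deriv ψ z • (1 : ℂ →L[ℝ] ℂ)) z :=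
    ((ψ.differentiableOn_coe z hz).differentiableAt (hS₁.mem_nhds hz)).hasDerivAt
      |>.complexToReal_fderiv
  have hUd : HasFDerivAt U (fderiv ℝ U (ψ z)) (ψ z) :=
    ((hU.differentiableOn_one (ψ z) (ψ.mapsTo hz)).differentiableAt
      (hS₂.mem_nhds (ψ.mapsTo hz))).hasFDerivAt
  exact hUd.comp z hψ

/-- Pointwise energy identity: `‖d(U ∘ ψ) z‖ ² = ‖ψ' z‖ ² · ‖dU (ψ z)‖ ²`. -/
private theorem norm_fderiv_comp_conformal_sq {S₁ S₂ : Set ℂ} (ψ : ConformalEquiv S₁ S₂)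
    (hS₁ : IsOpen S₁) (hS₂ : IsOpen S₂) {U : ℂ → ℝ} (hU : ContDiffOn ℝ 1 U S₂) {z : ℂ}
    (hz : z ∈ S₁) :
    ‖fderiv ℝ (fun w => U (ψ w)) z‖ ^ 2 = ‖deriv ψ z‖ ^ 2 * ‖fderiv ℝ U (ψ z)‖ ^ 2 := by
  rw [(hasFDerivAt_comp_conformal ψ hS₁ hS₂ hU hz).fderiv, norm_comp_smul_one, mul_pow]

/-- One inclusion of the conformal invariance of admissible energies: pulling back admissible
test functions of `R₂` along `ψ : R₁.carrier → R₂.carrier` (boundary values of `ψ` carrying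
`R₁.arc 0` into `R₂.arc 0` and `R₁.arc 2` into `R₂.arc 2`) gives admissible test functions of
`R₁` with the same Dirichlet energy. -/
private theorem energySet_subset (R₁ R₂ : ConformalRectangle)
    (ψ : ConformalEquiv R₁.carrier R₂.carrier)
    (h₀ : ∀ z ∈ R₁.arc 0, ∃ p ∈ R₂.arc 0, ψ.HasBoundaryValue z p)
    (h₂ : ∀ z ∈ R₁.arc 2, ∃ p ∈ R₂.arc 2, ψ.HasBoundaryValue z p) :
    {e : ℝ | ∃ U : ℂ → ℝ,
        (ContDiffOn ℝ 1 U R₂.carrier ∧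
          IntegrableOn (fun z => ‖fderiv ℝ U z‖ ^ 2) R₂.carrier ∧
          (∃ O : Set ℂ, IsOpen O ∧ R₂.arc 0 ⊆ O ∧ ∀ z ∈ O ∩ R₂.carrier, U z = 0) ∧
          (∃ O : Set ℂ, IsOpen O ∧ R₂.arc 2 ⊆ O ∧ ∀ z ∈ O ∩ R₂.carrier, U z = 1)) ∧
        e = ∫ z in R₂.carrier, ‖fderiv ℝ U z‖ ^ 2} ⊆
    {e : ℝ | ∃ U : ℂ → ℝ,
        (ContDiffOn ℝ 1 U R₁.carrier ∧
          IntegrableOn (fun z => ‖fderiv ℝ U z‖ ^ 2) R₁.carrier ∧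
          (∃ O : Set ℂ, IsOpen O ∧ R₁.arc 0 ⊆ O ∧ ∀ z ∈ O ∩ R₁.carrier, U z = 0) ∧
          (∃ O : Set ℂ, IsOpen O ∧ R₁.arc 2 ⊆ O ∧ ∀ z ∈ O ∩ R₁.carrier, U z = 1)) ∧
        e = ∫ z in R₁.carrier, ‖fderiv ℝ U z‖ ^ 2} := by
  rintro e ⟨U, ⟨hU₁, hU₂, hU₃, hU₄⟩, rfl⟩
  have hO₁ : IsOpen R₁.carrier := R₁.isOpen
  have hO₂ : IsOpen R₂.carrier := R₂.isOpen
  -- the real derivative of `ψ` within the carrier, and the change-of-variables data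
  have hd : ∀ x ∈ R₁.carrier,
      HasFDerivWithinAt ψ (deriv ψ x • (1 : ℂ →L[ℝ] ℂ)) R₁.carrier x := fun x hx =>
    (((ψ.differentiableOn_coe x hx).differentiableAt (hO₁.mem_nhds hx)).hasDerivAt
      |>.complexToReal_fderiv).hasFDerivWithinAt
  have himage : ψ '' R₁.carrier = R₂.carrier := ψ.bijOn.image_eq
  have hpt : ∀ x ∈ R₁.carrier,
      |(deriv ψ x • (1 : ℂ →L[ℝ] ℂ)).det| • ‖fderiv ℝ U (ψ x)‖ ^ 2 =
        ‖fderiv ℝ (fun w => U (ψ w)) x‖ ^ 2 := fun x hx => by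
    rw [det_smul_one, abs_of_nonneg (by positivity), smul_eq_mul,
      norm_fderiv_comp_conformal_sq ψ hO₁ hO₂ hU₁ hx]
  refine ⟨fun z => U (ψ z), ⟨?_, ?_, ?_, ?_⟩, ?_⟩
  · -- `C¹`: holomorphic maps are smooth on open sets
    exact hU₁.comp ((ψ.differentiableOn_coe.contDiffOn hO₁).restrict_scalars ℝ) ψ.mapsTo
  · -- finite energy, by the change of variables
    have hint := (integrableOn_image_iff_integrableOn_abs_det_fderiv_smul volume
      hO₁.measurableSet hd ψ.injOn (fun z => ‖fderiv ℝ U z‖ ^ 2)).1 (by rwa [himage])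
    exact hint.congr_fun (fun x hx => hpt x hx) hO₁.measurableSet
  · exact boundaryCondition_comp ψ ψ.mapsTo h₀ hU₃
  · exact boundaryCondition_comp ψ ψ.mapsTo h₂ hU₄
  · -- equality of energies, by the change of variables
    have hcv := integral_image_eq_integral_abs_det_fderiv_smul volume hO₁.measurableSet hd
      ψ.injOn (fun z => ‖fderiv ℝ U z‖ ^ 2)
    rw [himage] at hcv
    rw [hcv]
    exact setIntegral_congr_fun hO₁.measurableSet fun x hx => hpt x hx

/-- **Conformal invariance of the set of admissible Dirichlet energies** (Ahlfors, *Conformal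
Invariants*, Ch. 4). A conformal equivalence `ψ : R₁.carrier → R₂.carrier` between conformal
rectangles whose boundary values carry `R₁.arc 0` into `R₂.arc 0` and `R₁.arc 2` into
`R₂.arc 2`, and whose inverse does the same backwards, identifies the sets of Dirichlet energies
`∫ ‖dU‖ ²` of admissible test functions (`C¹` on the carrier, finite energy, `= 0` near `arc 0`,
`= 1` near `arc 2`): `U ↦ U ∘ ψ` and `V ↦ V ∘ ψ⁻¹` preserve admissibility and energy, since
`‖d(U ∘ ψ) z‖ = ‖ψ' z‖ ‖dU (ψ z)‖` and the real Jacobian of `ψ` is `‖ψ'‖ ²`. -/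
theorem stub_capacity_invariant :
    ∀ (R₁ R₂ : ConformalRectangle) (ψ : ConformalEquiv R₁.carrier R₂.carrier),
      (∀ z ∈ R₁.arc 0, ∃ p ∈ R₂.arc 0, ψ.HasBoundaryValue z p) →
      (∀ z ∈ R₁.arc 2, ∃ p ∈ R₂.arc 2, ψ.HasBoundaryValue z p) →
      (∀ p ∈ R₂.arc 0, ∃ z ∈ R₁.arc 0, ψ.symm.HasBoundaryValue p z) →
      (∀ p ∈ R₂.arc 2, ∃ z ∈ R₁.arc 2, ψ.symm.HasBoundaryValue p z) →
      {e : ℝ | ∃ U : ℂ → ℝ,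
          (ContDiffOn ℝ 1 U R₁.carrier ∧
            IntegrableOn (fun z => ‖fderiv ℝ U z‖ ^ 2) R₁.carrier ∧
            (∃ O : Set ℂ, IsOpen O ∧ R₁.arc 0 ⊆ O ∧ ∀ z ∈ O ∩ R₁.carrier, U z = 0) ∧
            (∃ O : Set ℂ, IsOpen O ∧ R₁.arc 2 ⊆ O ∧ ∀ z ∈ O ∩ R₁.carrier, U z = 1)) ∧
          e = ∫ z in R₁.carrier, ‖fderiv ℝ U z‖ ^ 2} =
      {e : ℝ | ∃ U : ℂ → ℝ,
          (ContDiffOn ℝ 1 U R₂.carrier ∧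
            IntegrableOn (fun z => ‖fderiv ℝ U z‖ ^ 2) R₂.carrier ∧
            (∃ O : Set ℂ, IsOpen O ∧ R₂.arc 0 ⊆ O ∧ ∀ z ∈ O ∩ R₂.carrier, U z = 0) ∧
            (∃ O : Set ℂ, IsOpen O ∧ R₂.arc 2 ⊆ O ∧ ∀ z ∈ O ∩ R₂.carrier, U z = 1)) ∧
          e = ∫ z in R₂.carrier, ‖fderiv ℝ U z‖ ^ 2} := by
  intro R₁ R₂ ψ h₀ h₂ h₀' h₂'
  exact Subset.antisymm (energySet_subset R₂ R₁ ψ.symm h₀' h₂') (energySet_subset R₁ R₂ ψ h₀ h₂)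

end Summit.CriticalPhenomena.CardyFormulaZ2.Theorems
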